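import Summits.MatrixMultiplication.OmegaCensus.BoxUsefulCentrelessSigned
import Summits.MatrixMultiplication.OmegaCensus.BoxUsefulCoordQuot
import Summits.MatrixMultiplication.OmegaCensus.CentreIndexSixGroups
import Summits.MatrixMultiplication.OmegaCensus.CentreIndexFourGroups

/-!
# ω-census, family (b3): conjecture C9 (b) — centreless endgame, part 4: a lawful centraliser makes `G` lawful

HONEST FRAMING (pub-omega census; verbatim): lottery ticket; floor = certified bounds/negative ranges.
Census BOOKKEEPING (conjecture C9 of the cell, STRUCTURE.md §2; pub-omega kernel-l4 gen 16, task K-5, structure part; the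
centreless branch, endgame part 4 — the induction step at a minimal normal `C₃`).  Setting as in parts 1–3: `G` box-useful of
order `2^a 3^b`, `Z(G) = 1`, `a ≠ 1 = a³` centralised or inverted by every element, `t` an inverter, `C = C_G(a)` (a subgroup
of index `2`, handed over as `C : Subgroup G` with its membership test).
* `Endgame.cube_of_central`: every element of `Z(C)` has cube `1` (parts 1–2: `t` inverts it, no involutions, `{2,3}`-group).
* `Endgame.CoordOne.*`, `Endgame.CoordTwo.*`: from a coordinate package on an abstract group `H` — `CentreIndexSix.Coord`
  (centre index `6`) resp. `DihC3Sq.Coord2` (class `𝒞₂`) — together with "central elements have cube `1`", either `H` is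
  abelian or `H` carries SIGNED DATA: the package's sign `ε` (multiplicative, `±1`, elements of sign `+1` commute and have
  cube `1`), an involution `y` of sign `−1` (the cube of any element of sign `−1`) and `u = c` resp. `c₁` inverted by `y`.
* `Endgame.lawful_of_lawful_centralizer`: **if `C` is lawful then `G` is lawful** — `[C:Z(C)] ∈ {1, 4}` makes `C` abelian
  (`comm_of_sq_comm`) and part 2 applies (`G ≅ S₃` or `Dih(C₃²)`); `[C:Z(C)] = 6` or `C ∈ 𝒞₂` gives signed data (or `C`
  abelian), which part 3 (`false_of_signed_centralizer`) rules out.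
What remains for C9 (b) on solvable `{2,3}`-groups: the existence of a minimal normal subgroup that is elementary abelian, and
the induction on `|G|` assembling `CentreLift.lawful_of_law_on_quotient` (centre), `TwoThree.no_normal_exp_two_of_centerless`,
`TwoThree.cyclic_of_minimal_normal` and this file.  Nothing here is progress on `ω`.
-/

namespace Summit.MatrixMultiplication.OmegaCensus

open Finset ProductBoxBound
open scoped commutatorElement

namespace Endgame

/-! ### Signed data from the centre-index-`6` package -/

namespace CoordOne

open CentreIndexSix

variable {H : Type*} [Group H] {c : H} {κ ε : H → ZMod 3} (h : Coord c κ ε)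
include h

/-- `ε(g)ⁿ = ε(gⁿ)` (the `Coord` analogue of `CoordLift.eps_pow`). [folklore] -/
theorem pow_eps (g : H) (n : ℕ) : ε g ^ n = ε (g ^ n) := by
  induction n with
  | zero => rw [pow_zero, pow_zero, h.eps_one]
  | succ n ih => rw [pow_succ, pow_succ, h.eps_mul, ih]

/-- Two elements of sign `+1` commute (the `Coord` analogue of `CoordLift.comm_of_eps_one`). [folklore] -/
theorem comm_of_eps_eq_one {x g : H} (hx : ε x = 1) (hg : ε g = 1) : g * x = x * g := by
  obtain ⟨u, hu, e⟩ := h.comm x g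
  have hu1 : u = 1 := by
    apply h.inK_eq_one hu
    have e1 := congrArg κ e
    rw [h.kap_mul, h.kap_mul, h.kap_mul, h.eps_mul, hx, hg] at e1
    linear_combination -e1
  rw [e, hu1, mul_one]

/-- An element of sign `+1` and coordinate `0` is central. [folklore] -/
theorem central_of_kap_zero {g : H} (hg : ε g = 1) (h0 : κ g = 0) (x : H) : x * g = g * x := by
  obtain ⟨u, hu, e⟩ := h.comm x g
  have hu1 : u = 1 := by
    apply h.inK_eq_one hu
    have e1 := congrArg κ e
    rw [h.kap_mul, h.kap_mul, h.kap_mul, h.eps_mul, hg, h0] at e1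
    rcases h.sign x with ex | ex <;> rw [ex] at e1
    · linear_combination -e1
    · linear_combination e1
  rw [e, hu1, mul_one]

/-- `κ(gⁿ) = n κ(g)` for `ε g = 1`. [folklore] -/
theorem kap_pow_of_eps_one {g : H} (hg : ε g = 1) (n : ℕ) : κ (g ^ n) = n * κ g := by
  induction n with
  | zero => rw [pow_zero, h.kap_one, Nat.cast_zero, zero_mul]
  | succ n ih => rw [pow_succ, h.kap_mul, ← pow_eps h, hg, one_pow, one_mul, ih]; push_cast; ring

/-- Elements of sign `−1` invert `c`. [folklore] -/
theorem conj_c_of_eps_neg {g : H} (hg : ε g = -1) : g * c * g⁻¹ = c⁻¹ := by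
  have hcinv : c⁻¹ = c * c := by rw [inv_eq_iff_mul_eq_one, h.c_mul_cc]
  rw [hcinv]
  apply h.inK_eq_of_kap (h.inK_conj (Or.inr (Or.inl rfl)) g) (Or.inr (Or.inr rfl))
  rw [h.kap_mul, h.kap_mul, h.eps_mul, h.kap_inv, h.kap_c, h.eps_c, hg, h.kap_cc]; ring

/-- If central elements have cube `1`, then so do all elements of sign `+1` (`g = k·α`, `k ∈ K`, `α` central). [folklore] -/
theorem cube_eq_one_of_eps_one (hA : ∀ α : H, (∀ x, x * α = α * x) → α ^ 3 = 1) {g : H} (hg : ε g = 1) :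
    g ^ 3 = 1 := by
  have hk3 : (c ^ (κ g).val) ^ 3 = 1 := by
    rw [← pow_mul, mul_comm, pow_mul, pow_three', h.ccc, one_pow]
  have hεk : ε (c ^ (κ g).val) = 1 := by rw [← pow_eps h, h.eps_c, one_pow]
  have hκk : κ (c ^ (κ g).val) = κ g := by
    rw [kap_pow_of_eps_one h h.eps_c, h.kap_c, mul_one, ZMod.natCast_zmod_val]
  have hεki : ε (c ^ (κ g).val)⁻¹ = 1 := by rw [h.eps_inv, hεk]
  have hα0 : κ ((c ^ (κ g).val)⁻¹ * g) = 0 := by rw [h.kap_mul, h.kap_inv, hεk, hκk, hεki]; ring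
  have hαε : ε ((c ^ (κ g).val)⁻¹ * g) = 1 := by rw [h.eps_mul, hεki, hg, mul_one]
  have hαc : ∀ x, x * ((c ^ (κ g).val)⁻¹ * g) = ((c ^ (κ g).val)⁻¹ * g) * x := central_of_kap_zero h hαε hα0
  have hcomm : Commute (c ^ (κ g).val) ((c ^ (κ g).val)⁻¹ * g) := hαc _
  calc g ^ 3 = (c ^ (κ g).val * ((c ^ (κ g).val)⁻¹ * g)) ^ 3 := by rw [mul_inv_cancel_left]
    _ = (c ^ (κ g).val) ^ 3 * ((c ^ (κ g).val)⁻¹ * g) ^ 3 := hcomm.mul_pow 3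
    _ = 1 := by rw [hk3, hA _ hαc, one_mul]

/-- **Signed data or abelian** (centre index `6` package). [folklore] -/
theorem signed_or_comm (hA : ∀ α : H, (∀ x, x * α = α * x) → α ^ 3 = 1) :
    (∀ x y : H, x * y = y * x) ∨
      ∃ y u : H, ε y = -1 ∧ y * y = 1 ∧ u ^ 3 = 1 ∧ u ≠ 1 ∧ y * u * y⁻¹ = u⁻¹ := by
  by_cases hab : ∀ g : H, ε g = 1
  · exact Or.inl fun x y => comm_of_eps_eq_one h (hab y) (hab x)
  · right
    push Not at hab
    obtain ⟨g, hg⟩ := hab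
    have hg' : ε g = -1 := (h.sign g).resolve_left hg
    refine ⟨g ^ 3, c, ?_, ?_, ?_, h.c_ne_one, conj_c_of_eps_neg h ?_⟩
    · rw [← pow_eps h, hg']; decide
    · have h2 : ε (g ^ 2) = 1 := by rw [← pow_eps h, hg']; decide
      rw [← pow_add, show 3 + 3 = 2 * 3 by rfl, pow_mul]
      exact cube_eq_one_of_eps_one h hA h2
    · rw [pow_three']; exact h.ccc
    · rw [← pow_eps h, hg']; decide

end CoordOne

/-! ### Signed data from the `𝒞₂` package -/

namespace CoordTwo

open DihC3Sq

variable {H : Type*} [Group H] {c₁ c₂ : H} {κ₁ κ₂ ε : H → ZMod 3} (h : Coord2 c₁ c₂ κ₁ κ₂ ε)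
include h

/-- If central elements have cube `1`, then so do all elements of sign `+1`. [folklore] -/
theorem cube_eq_one_of_eps_one (hA : ∀ α : H, (∀ x, x * α = α * x) → α ^ 3 = 1) {g : H} (hg : ε g = 1) :
    g ^ 3 = 1 := by
  obtain ⟨hκ1, hκ2⟩ := CoordLift.kap_inK_pow h (κ₁ g).val (κ₂ g).val
  rw [ZMod.natCast_zmod_val] at hκ1 hκ2
  have h13 : c₁ ^ 3 = 1 := by rw [pow_three']; exact h.c1_cube
  have h23 : c₂ ^ 3 = 1 := by rw [pow_three']; exact h.c2_cube
  have hc12 : Commute c₁ c₂ := h.c_comm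
  have hk3 : (c₁ ^ (κ₁ g).val * c₂ ^ (κ₂ g).val) ^ 3 = 1 := by
    rw [(hc12.pow_pow _ _).mul_pow, ← pow_mul, ← pow_mul, mul_comm (κ₁ g).val, mul_comm (κ₂ g).val, pow_mul,
      pow_mul, h13, h23, one_pow, one_pow, one_mul]
  have hεk : ε (c₁ ^ (κ₁ g).val * c₂ ^ (κ₂ g).val) = 1 := by
    rw [h.eps_mul, CoordLift.eps_pow h, CoordLift.eps_pow h, h.eps_c1, h.eps_c2, one_pow, one_pow, one_mul]
  set k := c₁ ^ (κ₁ g).val * c₂ ^ (κ₂ g).val with hk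
  have hεki : ε k⁻¹ = 1 := by rw [← h.eps_inv₂, hεk]
  have hα1 : κ₁ (k⁻¹ * g) = 0 := by rw [h.kap1_mul, h.kap1_inv, hεk, hκ1, hεki]; ring
  have hα2 : κ₂ (k⁻¹ * g) = 0 := by rw [h.kap2_mul, h.kap2_inv, hεk, hκ2, hεki]; ring
  have hαε : ε (k⁻¹ * g) = 1 := by rw [h.eps_mul, hεki, hg, mul_one]
  have hαc : ∀ x, x * (k⁻¹ * g) = (k⁻¹ * g) * x := CoordLift.central_of_kap_zero h hαε hα1 hα2
  have hcomm : Commute k (k⁻¹ * g) := hαc _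
  clear_value k
  calc g ^ 3 = (k * (k⁻¹ * g)) ^ 3 := by rw [mul_inv_cancel_left]
    _ = k ^ 3 * (k⁻¹ * g) ^ 3 := hcomm.mul_pow 3
    _ = 1 := by rw [hk3, hA _ hαc, one_mul]

/-- **Signed data or abelian** (`𝒞₂` package). [folklore] -/
theorem signed_or_comm (hA : ∀ α : H, (∀ x, x * α = α * x) → α ^ 3 = 1) :
    (∀ x y : H, x * y = y * x) ∨
      ∃ y u : H, ε y = -1 ∧ y * y = 1 ∧ u ^ 3 = 1 ∧ u ≠ 1 ∧ y * u * y⁻¹ = u⁻¹ := by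
  by_cases hab : ∀ g : H, ε g = 1
  · exact Or.inl fun x y => CoordLift.comm_of_eps_one h (hab x) (hab y)
  · right
    push Not at hab
    obtain ⟨g, hg⟩ := hab
    have hg' : ε g = -1 := (h.sign g).resolve_left hg
    refine ⟨g ^ 3, c₁, ?_, ?_, ?_, CoordLift.c1_ne_one h, CoordLift.conj_inK_of_eps_neg h (Or.inr (Or.inl rfl)) ?_⟩
    · rw [CoordLift.eps_pow h, hg']; decide
    · have h2 : ε (g ^ 2) = 1 := by rw [CoordLift.eps_pow h, hg']; decide
      rw [← pow_add, show 3 + 3 = 2 * 3 by rfl, pow_mul]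
      exact cube_eq_one_of_eps_one h hA h2
    · rw [pow_three']; exact h.c1_cube
    · rw [CoordLift.eps_pow h, hg']; decide

end CoordTwo

/-! ### The induction step -/

variable {G : Type*} [Group G] [Fintype G] [DecidableEq G]

/-- Elements of `Z(C)` have cube `1`. [folklore] -/
theorem cube_of_central (hG : BoxUseful G) (h23 : ∀ q : ℕ, q.Prime → q ∣ Fintype.card G → q = 2 ∨ q = 3)
    (hZ : Subgroup.center G = ⊥) {a t z : G} (hta : t * a * t⁻¹ = a⁻¹)
    (hall : ∀ g : G, g * a * g⁻¹ = a ∨ g * a * g⁻¹ = a⁻¹) (hz : z * a * z⁻¹ = a)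
    (hzC : ∀ c : G, c * a * c⁻¹ = a → z * c = c * z) : z ^ 3 = 1 := by
  have hpow : ∀ n : ℕ, ∀ c : G, c * a * c⁻¹ = a → z ^ n * c = c * z ^ n := by
    intro n c hc
    have h : Commute z c := hzC c hc
    exact (h.pow_left n).eq
  have hno : ∀ n : ℕ, z ^ n * z ^ n = 1 → z ^ n = 1 :=
    fun n hn => eq_one_of_sq hZ hta hall (hpow n) (cent_pow hz n) hn
  obtain ⟨k, hk⟩ := exists_pow_three_pow h23 (odd_orderOf hno)
  exact ThreeElt.pow_three_eq_one_of_inverted hG hk (inverts_of_central_in_centralizer hZ hta hall hzC hz)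

/-- **Lawful centraliser ⇒ lawful.**  In the centreless endgame setting, if the centraliser `C = C_G(a)` (given as a subgroup
with its membership test) satisfies C9 (b), then so does `G`. [folklore] -/
theorem lawful_of_lawful_centralizer (hG : BoxUseful G)
    (h23 : ∀ q : ℕ, q.Prime → q ∣ Fintype.card G → q = 2 ∨ q = 3) (hZ : Subgroup.center G = ⊥) {a t : G}
    (ha3 : a ^ 3 = 1) (ha1 : a ≠ 1) (hall : ∀ g : G, g * a * g⁻¹ = a ∨ g * a * g⁻¹ = a⁻¹) (hta : t * a * t⁻¹ = a⁻¹)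
    (C : Subgroup G) (hC : ∀ g : G, g ∈ C ↔ g * a * g⁻¹ = a)
    (IH : (Subgroup.center C).index = 1 ∨ (Subgroup.center C).index = 4 ∨ (Subgroup.center C).index = 6 ∨
      ∃ (c₁ c₂ : C) (κ₁ κ₂ ε : C → ZMod 3), DihC3Sq.Coord2 c₁ c₂ κ₁ κ₂ ε) :
    (Subgroup.center G).index = 1 ∨ (Subgroup.center G).index = 4 ∨ (Subgroup.center G).index = 6 ∨
      ∃ (c₁ c₂ : G) (κ₁ κ₂ ε : G → ZMod 3), DihC3Sq.Coord2 c₁ c₂ κ₁ κ₂ ε := by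
  classical
  -- (1) `C` abelian ⇒ lawful (part 2)
  have fromAb : (∀ x y : C, x * y = y * x) →
      ((Subgroup.center G).index = 1 ∨ (Subgroup.center G).index = 4 ∨ (Subgroup.center G).index = 6 ∨
        ∃ (c₁ c₂ : G) (κ₁ κ₂ ε : G → ZMod 3), DihC3Sq.Coord2 c₁ c₂ κ₁ κ₂ ε) := fun hab =>
    lawful_of_centralizer_comm hG h23 hZ ha3 ha1 hall hta (fun c d hc hd => by
      have e := congrArg Subtype.val (hab ⟨c, (hC c).2 hc⟩ ⟨d, (hC d).2 hd⟩)
      simpa using e)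
  -- (2) central elements of `C` have cube `1`
  have hA : ∀ α : C, (∀ x : C, x * α = α * x) → α ^ 3 = 1 := by
    intro α hα
    have h3 : (α : G) ^ 3 = 1 := cube_of_central hG h23 hZ hta hall ((hC α).1 α.2) (fun c hc => by
      have e := congrArg Subtype.val (hα ⟨c, (hC c).2 hc⟩)
      simp only [Subgroup.coe_mul] at e
      exact e.symm)
    exact Subtype.ext (by simpa using h3)
  -- (3) signed data on `C` is impossible (part 3)
  have fromSigned : ∀ (ε : C → ZMod 3), (∀ g, ε g = 1 ∨ ε g = -1) → (∀ g k, ε (g * k) = ε g * ε k) →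
      (∀ g k, ε g = 1 → ε k = 1 → g * k = k * g) → (∀ g, ε g = 1 → g ^ 3 = 1) →
      ∀ y u : C, ε y = -1 → y * y = 1 → u ^ 3 = 1 → u ≠ 1 → y * u * y⁻¹ = u⁻¹ → False := by
    intro ε hs hm hcm hcb y u hεy hy2 hu3 hu1 hyu
    let ε' : G → ZMod 3 := fun g => if hg : g * a * g⁻¹ = a then ε ⟨g, (hC g).2 hg⟩ else 1
    have hε' : ∀ (g : G) (hg : g * a * g⁻¹ = a), ε' g = ε ⟨g, (hC g).2 hg⟩ := fun g hg => dif_pos hg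
    have hy : (y : G) * a * (y : G)⁻¹ = a := (hC y).1 y.2
    have hu : (u : G) * a * (u : G)⁻¹ = a := (hC u).1 u.2
    refine false_of_signed_centralizer hG (y := y) (u := u) ε' ha3 ha1 hta ?_ ?_ ?_ ?_ hy ?_ ?_ hu ?_ ?_ ?_
    · intro c hc; rw [hε' c hc]; exact hs _
    · intro c d hc hd
      rw [hε' c hc, hε' d hd, hε' (c * d) (cent_mul hc hd)]
      exact hm ⟨c, (hC c).2 hc⟩ ⟨d, (hC d).2 hd⟩
    · intro c d hc hd h1 h2
      rw [hε' c hc] at h1; rw [hε' d hd] at h2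
      have e := congrArg Subtype.val (hcm _ _ h1 h2)
      simpa using e
    · intro c hc h1
      rw [hε' c hc] at h1
      have e := congrArg Subtype.val (hcb _ h1)
      simpa using e
    · rw [hε' _ hy]; exact hεy
    · have e := congrArg Subtype.val hy2; simpa using e
    · have e := congrArg Subtype.val hu3; simpa using e
    · exact fun e => hu1 (Subtype.ext (by simpa using e))
    · have e := congrArg Subtype.val hyu; simpa using e
  -- (4) the four cases of the induction hypothesis
  rcases IH with h1 | h4 | h6 | ⟨c₁, c₂, κ₁, κ₂, ε, hco⟩
  · apply fromAb
    intro x y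
    have htop : Subgroup.center C = ⊤ := Subgroup.index_eq_one.1 h1
    exact Subgroup.mem_center_iff.1 (by rw [htop]; exact Subgroup.mem_top y) x
  · apply fromAb
    intro x y
    have hsq : ∀ x c : G, x * a * x⁻¹ = a → c * a * c⁻¹ = a → (x * x) * c = c * (x * x) := by
      intro x c hx hc
      have hm := CentreIndexFour.sq_mem_center h4 (⟨x, (hC x).2 hx⟩ : C)
      have e := congrArg Subtype.val (Subgroup.mem_center_iff.1 hm ⟨c, (hC c).2 hc⟩)
      simp only [Subgroup.coe_mul] at e
      exact e.symm
    exact Subtype.ext (by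
      simpa using comm_of_sq_comm hZ hta hall hsq ((hC x).1 x.2) ((hC y).1 y.2))
  · obtain ⟨c, κ, ε, hco⟩ := CentreIndexSix.exists_coord h6
    rcases CoordOne.signed_or_comm hco hA with hab | ⟨y, u, hεy, hy2, hu3, hu1, hyu⟩
    · exact fromAb hab
    · exact (fromSigned ε hco.sign hco.eps_mul (fun g k hg hk => CoordOne.comm_of_eps_eq_one hco hk hg)
        (fun g => CoordOne.cube_eq_one_of_eps_one hco hA) y u hεy hy2 hu3 hu1 hyu).elim
  · rcases CoordTwo.signed_or_comm hco hA with hab | ⟨y, u, hεy, hy2, hu3, hu1, hyu⟩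
    · exact fromAb hab
    · exact (fromSigned ε hco.sign hco.eps_mul (fun g k => CoordLift.comm_of_eps_one hco)
        (fun g => CoordTwo.cube_eq_one_of_eps_one hco hA) y u hεy hy2 hu3 hu1 hyu).elim

end Endgame

end Summit.MatrixMultiplication.OmegaCensus
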